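import Summits.CriticalPhenomena.PercolationContinuityZ3.Theorems.Transplant.HeisenbergZSlabA
import Summits.CriticalPhenomena.PercolationContinuityZ3.Theorems.Transplant.SlabQuotientCriterion
import HarnessLib

/-!
# The cylinders of `H₃(ℤ) × ℤ` are STRICTLY subcritical at `p_c(H₃(ℤ) × ℤ)`: the residue
# `HeisenbergZCylSubcritical` of rung R3a DISCHARGED (the `a`-slab trick), so `θ_{H₃×ℤ}(p_c) = 0`
# hangs on the lane's single node alone

builds on p205010 (kernel theorem, internal audit signed; external expert review pending) — nothing in this file uses p205010.
Lane `prim-bschramm`, seat `prim-bschramm-p4` (gen 3; class map / abstract closing argument, memo `P4-GENERAL.md` §11),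
helper file (`--supports stmt-CriticalPhenomena-4575`).

`HeisenbergZPlanarSkeleton.lean` (gen 2) reduced `θ_{H₃(ℤ)×ℤ}(p_c) = 0` to the lane's node `SamePWitnessOfSkeleton` (or its drop
form `SamePDropOfSkeleton`) plus ONE named residue, `HeisenbergZCylSubcritical`: no cylinder `hzCyl ℓ = {|a| ≤ ℓ, |b| ≤ ℓ}` (all
`c`, all `t` — a THICK fibre `⟨C,T⟩ ≅ ℤ²`) percolates at `p_c(G)`, `G = Cay(H₃(ℤ) × ℤ; A, B, T)`.  It was recorded there as open
("Martineau–Severo inapplicable"): every subgroup of `G` moving the cylinder off itself has a NON-quasi-transitive quotient of `G`.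

This file proves the residue (§§1–6 = the companion file `HeisenbergZSlabA.lean` of this seat; §§7–10 below).  The point is
not to let the group act on `G` but on the intermediate **`a`-slab** `Σ_L = G[{|a| ≤ L}]` (`hzSlabA L`, `L = ℓ + 1 ≥ 1`):
* `Σ_L` is connected (§2: the cylinder `hzCyl L ⊆ Σ_L` is connected by gen 2's commutator walks, then `B`-steps), locally finite,
  and QUASI-TRANSITIVE under the left translations by the ABELIAN subgroup `{a = 0} = ⟨B, C, T⟩ ≅ ℤ³`, which preserve `a`
  (§3: `hzSlabShift`, `2L+1` orbit representatives `(a,0,0,0)`); it contains the edge-embedded grid `(b,t) ↦ (0,b,0,t)`, so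
  `p_c(Σ_L) < 1` (§6, the tree's Peierls lemma `GKZ.criticalProb_lt_one_of_latticeMap`);
* `Γ_N = ⟨B^N⟩` acting by LEFT multiplication, `(a,b,c,t) ↦ (a, b+N, c, t)` (§4: `BShift N`), is a free action on `Σ_L` by
  automorphisms which COMMUTES with every `hzSlabShift` (all of `{a = 0}` is abelian), so the shifts descend
  (`HeisenbergZ.quotIsoOfEquivariant`) and `Γ_N \ Σ_L` is quasi-transitive (§5) — exactly the hypotheses of Martineau–Severo's
  Cor. 2.2, a tree theorem (`MartineauSevero2019_cor22_holds`): `p_c(Σ_L) < p_c(Γ_N \ Σ_L)` (§7);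
* for `N = 2ℓ + 2` the cylinder `hzCyl ℓ` meets every `Γ_N`-orbit at most once and no edge joins it to a non-trivial translate
  (§8), so the abstract slab–quotient criterion (`QuotientSlab.criticalProb_lt_criticalProb_induce_of_slabQuotient`,
  `SlabQuotientCriterion.lean`: `p_c(G) ≤ p_c(Σ_L) < p_c(Γ_N \ Σ_L) ≤ p_c(G[hzCyl ℓ])`, the last step by the restriction
  coupling through `G[hzCyl ℓ] = (Γ_N \ Σ_L).comap`) gives **`p_c(G) < p_c(G[hzCyl ℓ])`** (`criticalProb_lt_criticalProb_hzCyl`)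
  and **`heisenbergZCylSubcritical_holds : HeisenbergZCylSubcritical`** (§9).
Consequences (§10): `hzSkeleton.CylSubcritical (p_c)` unconditionally, and the rung's closures from the node ALONE —
`heisenbergZCriticalContinuity_of_skeletonNode : SamePWitnessOfSkeleton → HeisenbergZCriticalContinuity`,
`heisenbergZCriticalContinuity_of_dropNode : SamePDropOfSkeleton → HeisenbergZCriticalContinuity`.  Nothing is claimed about the
node.  On the lane's class map this moves `H₃(ℤ) × ℤ` from "tier 2 (thick fibres, input (Φ2′) open)" to tier 1 (node only); the
general form of the trick (a quasi-transitive intermediate slab whose symmetry group centralises a planar translation) is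
recorded in `P4-GENERAL.md` §11.
[cite: MartineauSevero2019, Cor. 2.2] [cite: BenjaminiSchramm1996, Thm. 1 and Conj. 4] [cite: AizenmanGrimmett1991, Thm. 1 (the ℤ^d slab model)]
[cite: GrimmettPercolation1999, §1.4 (1.17)–(1.18); §7.1 p. 146]
-/

noncomputable section

open MeasureTheory

namespace Summit.CriticalPhenomena.PercolationContinuityZ3.Theorems.Transplant

open Literature.Probability.Percolation Literature.Probability.LatticeModels SimpleGraph
open Literature.Barriers.CriticalPhenomena (IsQuasiTransitive)
open HeisenbergZ

/-! ## §7 Martineau–Severo on the slab: `p_c(Σ_L) < p_c(Γ_N \ Σ_L)` -/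

/-- **Martineau–Severo, Cor. 2.2, applied to the `a`-slab**: `p_c(Σ_L) < p_c(Γ_N \ Σ_L)` for `L ≥ 1`, `N ≥ 1`
(connected, quasi-transitive, `p_c < 1`; free action by automorphisms with quasi-transitive quotient).
[cite: MartineauSevero2019, Cor. 2.2] -/
theorem criticalProb_hzSlabA_lt_quot {L N : ℕ} (hL : 1 ≤ L) (hN : N ≠ 0) :
    criticalProb (hzSlabAGraph L) (hzSlabAOrigin L) <
      criticalProb (orbitQuotientGraph (hzSlabAGraph L) (BShift N)) (qmk (BShift N) (hzSlabAOrigin L)) :=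
  MartineauSevero2019_cor22_holds (hzSlabA L) (hzSlabAGraph L) (BShift N) inferInstance
    (bShift_isActionByAut N L) (bShift_free hN) (hzSlabAGraph_connected hL)
    (hzSlabAGraph_quasiTransitive L) (bQuotient_quasiTransitive N L) (hzSlabAOrigin L) (criticalProb_hzSlabA_lt_one L)

/-! ## §8 The cylinder `hzCyl ℓ` embeds into the quotient (`ℓ ≤ L`, `N ≥ 2ℓ + 2`) -/

/-- `|N·n| < N` forces `n = 0`, i.e. `g = 1`. [folklore] -/
theorem BShift.eq_one_of_abs_lt {N : ℕ} (g : BShift N) (h : |(N : ℤ) * g.exp| < N) : g = 1 := by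
  have hexp : g.exp = 0 := by
    by_contra hne
    have h1le : 1 ≤ |g.exp| := Int.one_le_abs hne
    have : (N : ℤ) ≤ |(N : ℤ) * g.exp| := by
      rw [abs_mul, Nat.abs_cast]
      exact le_mul_of_one_le_right (by positivity) h1le
    linarith
  exact BShift.exp_injective (by simpa using hexp)

/-- A translate of a cylinder point that is again in the cylinder is the trivial translate (`N > 2ℓ`). [folklore] -/
theorem eq_one_of_smul_mem_hzCyl {ℓ L N : ℕ} (hN : 2 * ℓ < N) {g : BShift N} {x : hzSlabA L}
    (hx : (x : HZ) ∈ hzCyl ℓ) (hgx : ((g • x : hzSlabA L) : HZ) ∈ hzCyl ℓ) : g = 1 := by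
  apply BShift.eq_one_of_abs_lt
  have h1 : |(x : HZ) 1| ≤ ℓ := hx.2
  have h2 : |(x : HZ) 1 + N * g.exp| ≤ ℓ := by
    have := hgx.2
    rw [BShift.coe_smul, BShift.smul_def] at this
    simpa using this
  have hN' : (2 * ℓ : ℤ) < N := by exact_mod_cast hN
  rw [abs_le] at h1 h2
  rw [abs_lt]
  constructor <;> linarith [h1.1, h1.2, h2.1, h2.2]

/-- No edge of the slab joins a cylinder point to a non-trivial translate of a cylinder point (`N > 2ℓ + 1`): across an edge
`b` changes by at most `1`. [folklore] -/
theorem eq_one_of_adj_smul_hzCyl {ℓ L N : ℕ} (hN : 2 * ℓ + 1 < N) {g : BShift N} {x y : hzSlabA L}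
    (hx : (x : HZ) ∈ hzCyl ℓ) (hy : (y : HZ) ∈ hzCyl ℓ) (h : (hzSlabAGraph L).Adj x (g • y)) : g = 1 := by
  apply BShift.eq_one_of_abs_lt
  have hadj : heisenbergZGraph.Adj (x : HZ) ((g • y : hzSlabA L) : HZ) := h
  have hb := abs_hzAb_sub_le_one hadj 1
  rw [hzAb_apply_one, hzAb_apply_one, BShift.coe_smul, BShift.smul_def] at hb
  simp only [Matrix.cons_val_one, Matrix.cons_val_zero] at hb
  have h1 : |(x : HZ) 1| ≤ ℓ := hx.2
  have h2 : |(y : HZ) 1| ≤ ℓ := hy.2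
  have hN' : (2 * ℓ + 1 : ℤ) < N := by exact_mod_cast hN
  rw [abs_le] at h1 h2 hb
  rw [abs_lt]
  constructor <;> linarith [h1.1, h1.2, h2.1, h2.2, hb.1, hb.2]

/-! ## §9 Assembly: `p_c(G) < p_c(G[hzCyl ℓ])`, hence the residue -/

/-- **Strict subcriticality of every cylinder of `H₃(ℤ) × ℤ` at `p_c`**: `p_c(G) < p_c(G[hzCyl ℓ])`, via
`p_c(G) ≤ p_c(Σ_{ℓ+1}) < p_c(Γ_{2ℓ+2} \ Σ_{ℓ+1}) ≤ p_c(G[hzCyl ℓ])`. [cite: MartineauSevero2019, Cor. 2.2]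
[cite: AizenmanGrimmett1991, Thm. 1 (the ℤ^d slab model)] -/
theorem criticalProb_lt_criticalProb_hzCyl (ℓ : ℕ) :
    criticalProb heisenbergZGraph 0 < criticalProb (hzCylGraph ℓ) ⟨0, zero_mem_hzCyl ℓ⟩ := by
  have hL : 1 ≤ ℓ + 1 := Nat.le_add_left 1 ℓ
  have hN : 2 * ℓ + 1 < 2 * ℓ + 2 := Nat.lt_succ_self _
  have hN' : 2 * ℓ < 2 * ℓ + 2 := by omega
  have hN0 : 2 * ℓ + 2 ≠ 0 := Nat.succ_ne_zero _
  exact QuotientSlab.criticalProb_lt_criticalProb_induce_of_slabQuotient heisenbergZGraph (Γ := BShift (2 * ℓ + 2))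
    (hzCyl_subset_hzSlabA (Nat.le_succ ℓ)) (bShift_isActionByAut (2 * ℓ + 2) (ℓ + 1)) (bShift_free hN0)
    (hzSlabAGraph_connected hL) (hzSlabAGraph_quasiTransitive (ℓ + 1)) (bQuotient_quasiTransitive (2 * ℓ + 2) (ℓ + 1))
    (fun _ _ hy hgy => eq_one_of_smul_mem_hzCyl hN' hy hgy) (fun _ _ _ hy hz h => eq_one_of_adj_smul_hzCyl hN hy hz h)
    0 (zero_mem_hzCyl ℓ) (criticalProb_hzSlabA_lt_one (ℓ + 1))

/-- **THE RESIDUE OF RUNG R3a, DISCHARGED: no cylinder `{|a|,|b| ≤ ℓ}` of `H₃(ℤ) × ℤ` percolates at `p_c(H₃(ℤ) × ℤ)`.**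
[cite: MartineauSevero2019, Cor. 2.2] [cite: BenjaminiSchramm1996, Thm. 1] -/
theorem heisenbergZCylSubcritical_holds : HeisenbergZCylSubcritical := fun ℓ =>
  theta_eq_zero_of_lt_criticalProb_holds _ _ _ (criticalProb_lt_criticalProb_hzCyl ℓ)

/-! ## §10 Consequences: input Φ2 of `hzSkeleton` at `p_c`, and the rung from the node ALONE -/

/-- Input Φ2 of the planar skeleton of `H₃(ℤ) × ℤ` at `p_c`, unconditionally. [cite: MartineauSevero2019, Cor. 2.2] -/
theorem hzSkeleton_cylSubcritical : hzSkeleton.CylSubcritical (criticalProbIOf heisenbergZGraph 0) :=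
  hzSkeleton_cylSubcritical_of heisenbergZCylSubcritical_holds

/-- **`θ_{H₃(ℤ)×ℤ}(p_c) = 0` from the lane's single node `SamePWitnessOfSkeleton`, with NO further residue** (connected,
quasi-transitive, amenable — uniqueness by the tree's Burton–Keane —, planar skeleton `hzSkeleton`, cylinders at `p_c` by this file).
Conditional on the node only; the node is not claimed. [cite: BenjaminiSchramm1996, Conj. 4] [cite: KozmaNitzan2024, §1 p. 2 (approach 1)] -/
theorem heisenbergZCriticalContinuity_of_skeletonNode (hW : SamePWitnessOfSkeleton) : HeisenbergZCriticalContinuity :=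
  heisenbergZCriticalContinuity_of_skeletonNode_of_cylSubcritical hW heisenbergZCylSubcritical_holds

/-- **`θ_{H₃(ℤ)×ℤ}(p_c) = 0` from the lane's DROP node `SamePDropOfSkeleton` (design (D)), with NO further residue.**
Conditional on the node only; the node is not claimed. [cite: BenjaminiSchramm1996, Conj. 4] [cite: KozmaNitzan2024, §1 p. 2 (approach 1)] -/
theorem heisenbergZCriticalContinuity_of_dropNode (hD : SamePDropOfSkeleton) : HeisenbergZCriticalContinuity :=
  heisenbergZCriticalContinuity_of_dropNode_of_cylSubcritical hD heisenbergZCylSubcritical_holds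

end Summit.CriticalPhenomena.PercolationContinuityZ3.Theorems.Transplant

end
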